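import Literature.MathematicalPhysics.QuantumFieldTheory.Balaban1983to89.T4Covariance
import Literature.MathematicalPhysics.QuantumFieldTheory.Balaban1983to89.TorusGeometry
import Literature.MathematicalPhysics.QuantumFieldTheory.Balaban1983to89.B10Eq47AxialChi
import Literature.MathematicalPhysics.QuantumFieldTheory.Balaban1983to89.B10Eq71TorusOverlap

/-!
# Route `UnitScaleTilt` — crux K2 `HistoryTail` (stmt-QuantumFields-18916): THE NESTED REGIONS UNDER ONE PLAQUETTE — centres `c_s` down the
# averaging tower, boxes of radius `3(L^{j−s} − 1)` around them, closure under the translated squares of the (0.4) averaging, and the count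
# `#R_s ≤ (6L^{j−s})^d` (support file; the «local twin: shrinking boxes» of the (69)–(71) chain, pure torus geometry, route-independent imports)

Fleet lead `ym-ust-18916-p1` (gen 2), 2026-08-26.  The landed deterministic core of (71) for the route's averaging,
`HistoryTailSmallFactorLocal.smallFactor_deterministic_loc` (gen 0, p448327) — and its feed from the (α) interface at the composite minimiser,
`HistoryTailAlphaTopPlaquette.smallFactor71_top` (gen 2, p466694) — take as INPUT a family of nested regions `R_s ⊂ Plaq_s`, `s ≤ j`, with
(i) `R_j = {p′}`, (ii) closure: for `p ∈ R_{s+1}`, every translated unit square `⟨shiftN (shiftN (blockSite p.src r) p.ν t) p.μ s′, p.μ, p.ν⟩`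
(`r ∈ {0,…,L−1}^d`, `t, s′ < L`) of the one-step Stokes decomposition lies in `R_s`, and the remainder bookkeeping `HistoryTailRemainder.remainder_le`
(p445870) needs (iii) `#R_{s+1} ≤ N₀·(L^d)^{j−1−s}`.  [Balaban1985UV3] (69)–(70) p.273: «Σ_{x∈B^j(x₀)} L^{−3j} Σ_{p∈c(p′)_x} |U_k(∂p) − 1| … Δ′ =
B^j(x₀) ∪ B^j(y₀) ∪ B^j(z₀) ∪ B^j(w₀)» — the plaquettes involved all live in a bounded number of `j`-blocks around `p′`.  THIS FILE constructs such a
family ONCE, as torus geometry (no gauge fields, no measure, no route file imported):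

* `shift_apply'`, `shiftN_apply` — coordinates of the unit steps; `scaleCoord_intCast` — the cross-level scaling of an integer offset is `L`
  times the offset; `blockSite_eq_emb_add` — `blockSite y r = emb y + (r − (L−1)/2)` coordinatewise;
* `exists_centres` — a family `c_s ∈ T^{(s)}`, `s ≤ j`, with `c_j = p′.src` and `c_s = emb c_{s+1}` (block centres down the tower);
* **`exists_nested_regions`** — regions `R_s := {q ∈ Plaq_s | q ∥ p′, q.src ∈ c_s + [−ρ_s, ρ_s]^d}`, `ρ_s = 3(L^{j−s} − 1)`: (i), (ii) (the
  translated squares move a box point by at most `Lρ_{s+1} + 3(L−1) = ρ_s`), (iii) `#R_s ≤ (2ρ_s + 1)^d ≤ (6L^{j−s})^d`, and the FOOTPRINT clause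
  (every `q ∈ R_s` is parallel to `p′` with `q.src` in the box) from which the consumer derives the «boxes inside `Λ_j(h)`» hypothesis of
  `smallFactor71_top`.

WHAT THIS IS NOT: no statement about fields; the fine-torus footprint of the boxes (`toFine`) and its inclusion in a history's region are the
consumer's next step.

References: T. Bałaban, CMP 102 (1985) 255–275 [Balaban1985UV3] ((69)–(70) p.273); CMP 109 (1987) 249–301 [Balaban1987RG1] ((0.1)–(0.4) pp.251–253).
-/

noncomputable section

open scoped BigOperators

namespace Summit.QuantumFields.YangMills.Theorems.HistoryTailBlockRegions

open Literature.MathematicalPhysics.QuantumFieldTheory.Balaban1983to89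
open B10Eq47AxialChi (shiftN)
open B10Eq71TorusOverlap (plaq_ext)

variable {P : Params}

/-! ## §1 Coordinates of the unit steps, of the cross-level scaling of an integer offset, and of the block sites -/

/-- `(x + e_μ)_ι = x_ι + [ι = μ]`. [folklore] -/
theorem shift_apply' {j : ℕ} (x : Site P j) (μ ι : Fin P.d) :
    (x.shift μ) ι = x ι + (if ι = μ then 1 else 0) := by
  unfold Site.shift
  by_cases h : ι = μ
  · subst h; simp [Function.update_self]
  · simp [h]

/-- `(x + n·e_μ)_ι = x_ι + n·[ι = μ]`. [folklore] -/
theorem shiftN_apply {j : ℕ} (x : Site P j) (μ : Fin P.d) (n : ℕ) (ι : Fin P.d) :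
    (shiftN x μ n) ι = x ι + (if ι = μ then (n : ZMod (P.sitesPerDir j)) else 0) := by
  induction n with
  | zero => simp [shiftN]
  | succ n ih =>
    simp only [shiftN, shift_apply', ih]
    by_cases h : ι = μ
    · simp [h]; ring
    · simp [h]

/-- The cross-level scaling of an INTEGER offset: `scaleCoord (e) = L·e` (`scaleCoord` is additive with `scaleCoord 1 = L`). [cite: Balaban1987RG1, (0.1) p.251] -/
theorem scaleCoord_intCast (j : ℕ) (e : ℤ) :
    Site.scaleCoord P j ((e : ℤ) : ZMod (P.sitesPerDir (j + 1))) = (((P.L : ℤ) * e : ℤ) : ZMod (P.sitesPerDir j)) := by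
  have h1 : ((e : ℤ) : ZMod (P.sitesPerDir (j + 1))) = e • (1 : ZMod (P.sitesPerDir (j + 1))) := (zsmul_one e).symm
  rw [h1, map_zsmul, Site.scaleCoord_one, zsmul_eq_mul]
  push_cast
  ring

/-- Block sites against block centres, coordinatewise: `blockSite y r ι = emb y ι + (r ι − (L−1)/2)`. [cite: Balaban1987RG1, (0.3) p.252] -/
theorem blockSite_eq_emb_add {j : ℕ} (y : Site P (j + 1)) (r : Fin P.d → Fin P.L) (ι : Fin P.d) :
    Site.blockSite y r ι = emb y ι + ((((r ι : ℕ) : ℤ) - (((P.L - 1) / 2 : ℕ) : ℤ) : ℤ) : ZMod (P.sitesPerDir j)) := by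
  set h : ℕ := (P.L - 1) / 2 with hh
  show (((y ι).val * P.L + r ι : ℕ) : ZMod (P.sitesPerDir j)) =
    (((y ι).val * P.L + h : ℕ) : ZMod (P.sitesPerDir j)) + _
  push_cast
  ring

/-! ## §2 Block centres down the tower -/

/-- **CENTRES DOWN THE TOWER**: for a site `y ∈ T^{(j)}` a family `c_s ∈ T^{(s)}` with `c_j = y` and `c_s = emb c_{s+1}` for `s < j` (the block
centres under `y` at every finer level; `toFine`'s chain made into a family). [cite: Balaban1987RG1, (0.1) p.252] -/
theorem exists_centres : ∀ (j : ℕ) (y : Site P j),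
    ∃ ctr : (s : ℕ) → Site P s, ctr j = y ∧ ∀ s, s < j → ctr s = emb (ctr (s + 1)) := by
  intro j
  induction j with
  | zero =>
    intro y
    refine ⟨fun s => if h : s = 0 then h.symm ▸ y else 0, by simp, fun s hs => (Nat.not_lt_zero s hs).elim⟩
  | succ j ih =>
    intro y
    obtain ⟨c, hc, hstep⟩ := ih (emb y)
    refine ⟨fun s => if h : s = j + 1 then h.symm ▸ y else c s, by simp, fun s hs => ?_⟩
    have hne : s ≠ j + 1 := Nat.ne_of_lt hs
    by_cases hsj : s = j
    · subst hsj
      simp only [hne, dif_neg, not_false_eq_true, dif_pos, hc]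
    · have hs' : s < j := by omega
      have hne' : s + 1 ≠ j + 1 := by omega
      simp only [hne, hne', dif_neg, not_false_eq_true, hstep s hs']

/-! ## §3 The nested regions under a plaquette -/

/-- The radius recursion: `L·ρ_{s+1} + 3(L − 1) = ρ_s` for `ρ_s = 3(L^{j−s} − 1)`, `s < j`. [folklore] -/
theorem radius_step {j s : ℕ} (hs : s < j) :
    (P.L : ℤ) * (3 * ((P.L : ℤ) ^ (j - (s + 1)) - 1)) + 3 * ((P.L : ℤ) - 1) = 3 * ((P.L : ℤ) ^ (j - s) - 1) := by
  have h : j - s = j - (s + 1) + 1 := by omega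
  rw [h, pow_succ]
  ring

/-- **THE NESTED REGIONS UNDER ONE PLAQUETTE** (input of `HistoryTailSmallFactorLocal.smallFactor_deterministic_loc` / `HistoryTailAlphaTopPlaquette.
smallFactor71_top` and of `HistoryTailRemainder.remainder_le`): for `p′ ∈ Plaq_j` there are centres `c_s` (`c_j = p′.src`, `c_s = emb c_{s+1}`) and
regions `R_s ⊂ Plaq_s` with `R_j = {p′}`; every `q ∈ R_s` (`s ≤ j`) parallel to `p′` with `q.src ∈ c_s + [−3(L^{j−s}−1), 3(L^{j−s}−1)]^d`
(coordinatewise integer offsets); `#R_s ≤ (6L^{j−s})^d`; and CLOSURE under the translated unit squares of the one-step Stokes decomposition of the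
(0.4) averaging: `⟨shiftN (shiftN (blockSite q.src r) q.ν t) q.μ s′, q.μ, q.ν⟩ ∈ R_s` for `q ∈ R_{s+1}`, `r ∈ {0,…,L−1}^d`, `t, s′ < L`.
[cite: Balaban1985UV3, (69)-(70) p.273] -/
theorem exists_nested_regions {j : ℕ} (p' : Plaq P j) :
    ∃ (ctr : (s : ℕ) → Site P s) (R : (s : ℕ) → Finset (Plaq P s)),
      ctr j = p'.src ∧ (∀ s, s < j → ctr s = emb (ctr (s + 1))) ∧ R j = {p'} ∧
      (∀ s, s ≤ j → ∀ q ∈ R s, q.μ = p'.μ ∧ q.ν = p'.ν ∧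
        ∀ ι, ∃ e : ℤ, |e| ≤ 3 * ((P.L : ℤ) ^ (j - s) - 1) ∧ q.src ι = ctr s ι + (e : ZMod (P.sitesPerDir s))) ∧
      (∀ s, s ≤ j → ((R s).card : ℝ) ≤ (6 * (P.L : ℝ) ^ (j - s)) ^ P.d) ∧
      (∀ s, s < j → ∀ q ∈ R (s + 1), ∀ (r : Fin P.d → Fin P.L), ∀ t ∈ Finset.range P.L, ∀ s' ∈ Finset.range P.L,
        (⟨shiftN (shiftN (Site.blockSite q.src r) q.ν t) q.μ s', q.μ, q.ν, q.hμν⟩ : Plaq P s) ∈ R s) := by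
  classical
  obtain ⟨ctr, hcj, hstep⟩ := exists_centres j p'.src
  -- the box predicate and the regions
  let box : (s : ℕ) → Site P s → Prop := fun s z =>
    ∀ ι, ∃ e : ℤ, |e| ≤ 3 * ((P.L : ℤ) ^ (j - s) - 1) ∧ z ι = ctr s ι + (e : ZMod (P.sitesPerDir s))
  let R : (s : ℕ) → Finset (Plaq P s) := fun s =>
    Finset.univ.filter fun q => q.μ = p'.μ ∧ q.ν = p'.ν ∧ box s q.src
  have hmem : ∀ s (q : Plaq P s), q ∈ R s ↔ q.μ = p'.μ ∧ q.ν = p'.ν ∧ box s q.src := fun s q => by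
    simp only [R, Finset.mem_filter, Finset.mem_univ, true_and]
  have hL0 : 0 < P.L := zero_lt_one.trans P.hL.2
  have hL1 : (1 : ℤ) ≤ (P.L : ℤ) := by exact_mod_cast P.hL.2.le
  refine ⟨ctr, R, hcj, hstep, ?_, ?_, ?_, ?_⟩
  · -- (i) `R_j = {p'}`: the radius at level `j` is `0`
    ext q
    rw [hmem, Finset.mem_singleton]
    constructor
    · rintro ⟨hμ, hν, hb⟩
      refine plaq_ext (funext fun ι => ?_) hμ hν
      obtain ⟨e, he, hq⟩ := hb ι
      have he0 : e = 0 := by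
        have : |e| ≤ 0 := by simpa using he
        exact abs_nonpos_iff.mp this
      rw [hq, hcj, he0]; simp
    · intro h
      subst h
      exact ⟨rfl, rfl, fun ι => ⟨0, by simp, by rw [hcj]; simp⟩⟩
  · -- footprint: the defining property of the filter
    intro s _ q hq
    exact (hmem s q).mp hq
  · -- (iii) the count: an injection into `{0,…,2ρ}^d`
    intro s _
    set ρ : ℕ := 3 * (P.L ^ (j - s) - 1) with hρ
    have hpow1 : 1 ≤ P.L ^ (j - s) := Nat.one_le_pow _ _ hL0
    have hρZ : (ρ : ℤ) = 3 * ((P.L : ℤ) ^ (j - s) - 1) := by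
      rw [hρ]; push_cast [Nat.cast_sub hpow1]; ring
    have hoff : ∀ q ∈ R s, ∀ ι, ∃ e : ℤ, |e| ≤ (ρ : ℤ) ∧ q.src ι = ctr s ι + (e : ZMod (P.sitesPerDir s)) := by
      intro q hq ι
      obtain ⟨e, he, h⟩ := ((hmem s q).mp hq).2.2 ι
      exact ⟨e, hρZ ▸ he, h⟩
    choose! e he hsrc using hoff
    let f : Plaq P s → (Fin P.d → Fin (2 * ρ + 1)) := fun q ι =>
      ⟨min (e q ι + ρ).toNat (2 * ρ), by omega⟩
    -- `f` restricted to `R s` is injective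
    have hcard : (R s).card ≤ (Finset.univ : Finset (Fin P.d → Fin (2 * ρ + 1))).card := by
      refine Finset.card_le_card_of_injOn f (fun q _ => Finset.mem_univ _) ?_
      intro q₁ hq₁ q₂ hq₂ hf
      have hq₁' := (hmem s q₁).mp (Finset.mem_coe.mp hq₁)
      have hq₂' := (hmem s q₂).mp (Finset.mem_coe.mp hq₂)
      refine plaq_ext (funext fun ι => ?_) (hq₁'.1.trans hq₂'.1.symm) (hq₁'.2.1.trans hq₂'.2.1.symm)
      have hfι : min (e q₁ ι + ρ).toNat (2 * ρ) = min (e q₂ ι + ρ).toNat (2 * ρ) := by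
        have := congrArg (fun g => ((g ι : Fin (2 * ρ + 1)) : ℕ)) hf
        simpa [f] using this
      have h1 := abs_le.mp (he q₁ (Finset.mem_coe.mp hq₁) ι)
      have h2 := abs_le.mp (he q₂ (Finset.mem_coe.mp hq₂) ι)
      have hm1 : min (e q₁ ι + ρ).toNat (2 * ρ) = (e q₁ ι + ρ).toNat := min_eq_left (by omega)
      have hm2 : min (e q₂ ι + ρ).toNat (2 * ρ) = (e q₂ ι + ρ).toNat := min_eq_left (by omega)
      rw [hm1, hm2] at hfι
      have heq : e q₁ ι = e q₂ ι := by omega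
      rw [hsrc q₁ (Finset.mem_coe.mp hq₁) ι, hsrc q₂ (Finset.mem_coe.mp hq₂) ι, heq]
    have huniv : (Finset.univ : Finset (Fin P.d → Fin (2 * ρ + 1))).card = (2 * ρ + 1) ^ P.d := by
      rw [Finset.card_univ, Fintype.card_fun, Fintype.card_fin, Fintype.card_fin]
    have hρR : ((2 * ρ + 1 : ℕ) : ℝ) ≤ 6 * (P.L : ℝ) ^ (j - s) := by
      rw [hρ]; push_cast [Nat.cast_sub hpow1]; linarith
    calc ((R s).card : ℝ) ≤ (((2 * ρ + 1) ^ P.d : ℕ) : ℝ) := by exact_mod_cast huniv ▸ hcard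
      _ = ((2 * ρ + 1 : ℕ) : ℝ) ^ P.d := by push_cast; ring
      _ ≤ (6 * (P.L : ℝ) ^ (j - s)) ^ P.d := pow_le_pow_left₀ (by positivity) hρR _
  · -- (ii) closure under the translated unit squares
    intro s hs q hq r t ht s' hs'
    obtain ⟨hμ, hν, hb⟩ := (hmem (s + 1) q).mp hq
    rw [hmem]
    refine ⟨hμ, hν, fun ι => ?_⟩
    obtain ⟨e', he', hq'⟩ := hb ι
    have ht' : t < P.L := Finset.mem_range.mp ht
    have hs'' : s' < P.L := Finset.mem_range.mp hs'
    -- the integer offset of the new base point at level `s`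
    refine ⟨(P.L : ℤ) * e' + (((r ι : ℕ) : ℤ) - (((P.L - 1) / 2 : ℕ) : ℤ)) +
        (if ι = q.ν then (t : ℤ) else 0) + (if ι = q.μ then (s' : ℤ) else 0), ?_, ?_⟩
    · -- the bound `|E| ≤ L·ρ_{s+1} + 3(L−1) = ρ_s`
      have h1 := abs_le.mp he'
      have hr : ((r ι : ℕ) : ℤ) ≤ (P.L : ℤ) - 1 := by
        have := (r ι).isLt
        omega
      have hr0 : (0 : ℤ) ≤ ((r ι : ℕ) : ℤ) := by positivity
      have hh : ((((P.L - 1) / 2 : ℕ) : ℤ)) ≤ (P.L : ℤ) - 1 := by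
        have : (P.L - 1) / 2 ≤ P.L - 1 := Nat.div_le_self _ _
        omega
      have hh0 : (0 : ℤ) ≤ (((P.L - 1) / 2 : ℕ) : ℤ) := by positivity
      have htI : (0 : ℤ) ≤ (if ι = q.ν then (t : ℤ) else 0) ∧ (if ι = q.ν then (t : ℤ) else 0) ≤ (P.L : ℤ) - 1 := by
        split_ifs
        · constructor <;> omega
        · constructor <;> omega
      have hsI : (0 : ℤ) ≤ (if ι = q.μ then (s' : ℤ) else 0) ∧ (if ι = q.μ then (s' : ℤ) else 0) ≤ (P.L : ℤ) - 1 := by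
        split_ifs
        · constructor <;> omega
        · constructor <;> omega
      have hLe1 : (P.L : ℤ) * e' ≤ (P.L : ℤ) * (3 * ((P.L : ℤ) ^ (j - (s + 1)) - 1)) :=
        mul_le_mul_of_nonneg_left h1.2 (by linarith)
      have hLe2 : (P.L : ℤ) * -(3 * ((P.L : ℤ) ^ (j - (s + 1)) - 1)) ≤ (P.L : ℤ) * e' :=
        mul_le_mul_of_nonneg_left h1.1 (by linarith)
      have hstepρ := radius_step (P := P) hs
      rw [abs_le]
      constructor
      · nlinarith [htI.1, hsI.1]
      · nlinarith [htI.2, hsI.2]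
    · -- the identity of coordinates
      show (shiftN (shiftN (Site.blockSite q.src r) q.ν t) q.μ s') ι = _
      rw [shiftN_apply, shiftN_apply, blockSite_eq_emb_add]
      have hemb : emb q.src ι = ctr s ι + (((P.L : ℤ) * e' : ℤ) : ZMod (P.sitesPerDir s)) := by
        have hq1 : q.src = ctr (s + 1) +
            (show Site P (s + 1) from fun κ => if κ = ι then ((e' : ℤ) : ZMod (P.sitesPerDir (s + 1))) else q.src κ - ctr (s + 1) κ) := by
          funext κ
          show q.src κ = ctr (s + 1) κ + (if κ = ι then ((e' : ℤ) : ZMod (P.sitesPerDir (s + 1))) else q.src κ - ctr (s + 1) κ)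
          by_cases hκ : κ = ι
          · subst hκ; simp [hq']
          · simp [hκ]
        rw [hq1, Site.emb_add, hstep s hs]
        show emb (ctr (s + 1)) ι + Site.scale _ ι = emb (ctr (s + 1)) ι + _
        rw [Site.scale_apply]
        simp only [if_true]
        rw [scaleCoord_intCast]
      rw [hemb]
      push_cast
      by_cases h1 : ι = q.ν <;> by_cases h2 : ι = q.μ <;> simp [h1, h2] <;> ring

end Summit.QuantumFields.YangMills.Theorems.HistoryTailBlockRegions

end
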